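import Literature.MathematicalPhysics.QuantumFieldTheory.LatticeGaugeStaticPotentialProofs
import Literature.MathematicalPhysics.QuantumFieldTheory.ConstructiveQFTWave0WilsonLoopRPProofs
import Literature.MathematicalPhysics.QuantumFieldTheory.ConstructiveQFTWave0WilsonLoopOddProofs
import Literature.MathematicalPhysics.QuantumFieldTheory.StringTensionAnalysis
import HarnessLib

/-!
# Static potential of infinite-volume lattice gauge states (S12): proofs, part 2 (limit)

Sibling proofs file of `LatticeGauge.lean` (named fact `exists_hasStaticPotential`). Here the
torus Gram inequalities of `ConstructiveQFTWave0WilsonLoopRPProofs` (reflection positivity of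
the even torus in hyperplanes through and between sites) are passed to an infinite-volume limit
point `μ` along a subsequence of tori containing infinitely many EVEN sizes, giving for
`W(T) = W_μ(T × R)` (loops with `T` steps in the time direction `0`):
`W(T) ≥ 0` and the log-convexity `W(T+1)² ≤ W(T) W(T+2)` (`2 × 2` Gram determinants), besides
`W(0) = 1`, `W ≤ 1`. With the coordinate swap and the log-convexity dichotomy of part 1 this
proves the transfer-matrix dichotomy of `exists_hasStaticPotential` for all limit points along
subsequences with infinitely many even torus sizes
(`exists_hasStaticPotential_of_frequently_even`); the remaining case (infinitely many ODD sizes)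
is the same argument with the Gram inequalities of the odd torus
(`ConstructiveQFTWave0WilsonLoopOddProofs`, reflection positivity of the odd torus in its
hyperplane between sites and its hyperplane through sites). Since one of the two cases always
occurs, this DISCHARGES the named fact: `exists_hasStaticPotential_holds`.

References: E. Seiler, LNP 159 (1982), §2 (static potential from reflection positivity and the
transfer matrix); K. Osterwalder, E. Seiler, Ann. Phys. 110 (1978) 440, §2. All statements here
are proved. [folklore]
-/

noncomputable section

open MeasureTheory Filter Topology
open Literature.MathematicalPhysics.QuantumLattice Literature.Probability.LatticeModels

namespace Literature.MathematicalPhysics.QuantumFieldTheory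

namespace StaticPotential

/-! ### Elementary: the `2 × 2` Gram determinant -/

/-- If the real quadratic form `A x² + 2 B x y + C y²` is non-negative then `B² ≤ A C`. [folklore] -/
theorem sq_le_mul_of_forall_quadratic_nonneg {A B C : ℝ}
    (h : ∀ x y : ℝ, 0 ≤ A * x ^ 2 + 2 * B * x * y + C * y ^ 2) : B ^ 2 ≤ A * C := by
  have hA : 0 ≤ A := by simpa using h 1 0
  rcases hA.eq_or_lt with hA0 | hApos
  · have hB : B = 0 := by
      by_contra hB
      have h1 := h (-(C + 1) / (2 * B)) 1
      have h2 : 2 * B * (-(C + 1) / (2 * B)) * 1 = -(C + 1) := by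
        field_simp
      rw [← hA0, h2] at h1
      linarith
    rw [hB, ← hA0]
    simp
  · have h1 := h (-B) A
    have h2 : A * (-B) ^ 2 + 2 * B * -B * A + C * A ^ 2 = A * (A * C - B ^ 2) := by ring
    rw [h2] at h1
    linarith [nonneg_of_mul_nonneg_right h1 hApos]

end StaticPotential

section Limit

variable {d N : ℕ} {G : Type*} [Group G] [TopologicalSpace G] [IsTopologicalGroup G]
  [CompactSpace G] [MeasurableSpace G] [BorelSpace G] (ρ : G →* Matrix (Fin N) (Fin N) ℂ)

/-! ### Limit points along a given subsequence -/

/-- Coordinate permutations preserve limits along a given subsequence of tori (the version of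
`map_configPermZd_mem_infiniteVolumeLimitPoints` keeping the subsequence). [folklore] -/
theorem IsInfiniteVolumeLimitAlong.map_configPermZd (hρ : Continuous ρ) {β : ℝ} {φ : ℕ → ℕ}
    {μ : Measure (LGConfig d G)} (hμ : IsInfiniteVolumeLimitAlong ρ β φ μ)
    (π : Equiv.Perm (Fin d)) :
    IsInfiniteVolumeLimitAlong ρ β φ (μ.map (configPermZd π)) := by
  obtain ⟨hprob, hconv⟩ := hμ
  haveI := hprob
  refine ⟨Measure.isProbabilityMeasure_map (configPermZd π).measurable.aemeasurable, ?_⟩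
  intro F S hFS hFc hFb
  rw [integral_map_equiv]
  have h := hconv (F ∘ configPermZd π) _ (IsCylinder.comp_configPermZd hFS π)
    (hFc.comp (continuous_configPermZd π))
    (by obtain ⟨C, hC⟩ := hFb; exact ⟨C, fun U => hC _⟩)
  have hE : ∀ L : ℕ, wilsonExpectation (L := L + 1) ρ β
      (toTorusObservable (L + 1) (F ∘ configPermZd π)) =
      wilsonExpectation (L := L + 1) ρ β (toTorusObservable (L + 1) F) := fun L => by
    rw [toTorusObservable_comp_configPermZd, wilsonExpectation_comp_configPerm ρ hρ]
  simp only [hE, Function.comp_apply] at h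
  exact h

/-! ### Gram inequalities pass to the limit -/

/-- **Torus Gram inequalities holding for infinitely many tori of the defining subsequence pass
to the limit point.** [folklore] -/
theorem gram_rectExpectation_nonneg_of_frequently [NeZero d] (hρ : Continuous ρ) {β : ℝ}
    {μ : Measure (LGConfig d G)} {φ : ℕ → ℕ} (hlim : IsInfiniteVolumeLimitAlong ρ β φ μ)
    (h : ℕ → ℕ → ℕ) (R : ℕ) (S : Finset ℕ) (c : ℕ → ℝ)
    (hG : ∃ᶠ k in atTop, 0 ≤ ∑ a ∈ S, ∑ b ∈ S, c a * c b *
      wilsonExpectation (L := φ k + 1) ρ β (wilsonLoop ρ (0 : Site d (φ k + 1)) 0 1 (h a b) R)) :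
    0 ≤ ∑ a ∈ S, ∑ b ∈ S, c a * c b *
      rectExpectation μ (fun g => normalisedCharacter N (ρ g)) 0 1 (h a b) R := by
  obtain ⟨ψ, hψ, hψG⟩ := extraction_of_frequently_atTop hG
  have ht : Tendsto (fun k : ℕ => ∑ a ∈ S, ∑ b ∈ S, c a * c b *
      wilsonExpectation (L := φ k + 1) ρ β (wilsonLoop ρ (0 : Site d (φ k + 1)) 0 1 (h a b) R))
      atTop (𝓝 (∑ a ∈ S, ∑ b ∈ S, c a * c b *
        rectExpectation μ (fun g => normalisedCharacter N (ρ g)) 0 1 (h a b) R)) :=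
    tendsto_finsetSum _ fun a _ => tendsto_finsetSum _ fun b _ =>
      (tendsto_wilsonExpectation_wilsonLoop ρ hρ hlim (h a b) R).const_mul _
  exact ge_of_tendsto' (ht.comp hψ.tendsto_atTop) fun n => hψG n

omit [TopologicalSpace G] [IsTopologicalGroup G] [CompactSpace G] [BorelSpace G] in
/-- From the `2 × 2` Gram sum over `{a, a+1}` with coefficients `(x, y)` to the quadratic form.
[folklore] -/
private theorem quad_of_gram_pair {W : ℕ → ℝ} {h : ℕ → ℕ → ℕ} {a p q r : ℕ} {x y : ℝ}
    (hp : h a a = p) (hq : h a (a + 1) = q) (hq' : h (a + 1) a = q) (hr : h (a + 1) (a + 1) = r)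
    (hG : 0 ≤ ∑ s ∈ ({a, a + 1} : Finset ℕ), ∑ t ∈ ({a, a + 1} : Finset ℕ),
      (if s = a then x else y) * (if t = a then x else y) * W (h s t)) :
    0 ≤ W p * x ^ 2 + 2 * W q * x * y + W r * y ^ 2 := by
  have hne : a ≠ a + 1 := by omega
  rw [Finset.sum_pair hne, Finset.sum_pair hne, Finset.sum_pair hne] at hG
  simp only [↓reduceIte, if_neg hne.symm, hp, hq, hq', hr] at hG
  have e : W p * x ^ 2 + 2 * W q * x * y + W r * y ^ 2 =
      x * x * W p + x * y * W q + (y * x * W q + y * y * W r) := by ring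
  rw [e]
  exact hG

/-- **The Gram inequalities in the limit (subsequences with infinitely many even tori).** For
`μ` an infinite-volume limit along tori `Λ_{φ k + 1}` with `φ k + 1` even for infinitely many
`k`, continuous `ρ`, `β ≥ 0`, `d ≥ 2` and every `R`, the loop expectations
`W(T) = W_μ(T × R)` (rectangle at the origin with `T` steps in direction `0` and `R` in direction
`1`) satisfy `W(T) ≥ 0` and `W(T+1)² ≤ W(T) W(T+2)` for all `T`
(Seiler LNP 159 §2: positivity of the transfer matrix from reflection positivity in hyperplanes
with and without sites). [folklore] -/
theorem rectExpectation_nonneg_and_logConvex_of_frequently_even [NeZero d] (hd : 2 ≤ d)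
    (hρ : Continuous ρ) {β : ℝ} (hβ : 0 ≤ β) {μ : Measure (LGConfig d G)} {φ : ℕ → ℕ}
    (hφ : StrictMono φ) (hlim : IsInfiniteVolumeLimitAlong ρ β φ μ)
    (hpar : ∃ᶠ k in atTop, Even (φ k + 1)) (R T : ℕ) :
    0 ≤ rectExpectation μ (fun g => normalisedCharacter N (ρ g)) 0 1 T R ∧
      rectExpectation μ (fun g => normalisedCharacter N (ρ g)) 0 1 (T + 1) R ^ 2 ≤
        rectExpectation μ (fun g => normalisedCharacter N (ρ g)) 0 1 T R *
          rectExpectation μ (fun g => normalisedCharacter N (ρ g)) 0 1 (T + 2) R := by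
  set W : ℕ → ℝ := fun T => rectExpectation μ (fun g => normalisedCharacter N (ρ g)) 0 1 T R
    with hW
  have h1 : (1 : Fin d) ≠ 0 := by
    intro h01
    have := congrArg Fin.val h01
    rw [Fin.val_zero, Fin.val_one', Nat.one_mod_eq_one.mpr (by omega)] at this
    exact one_ne_zero this
  -- infinitely many even tori which are moreover large
  have hfreq : ∀ m : ℕ, ∃ᶠ k in atTop, Even (φ k + 1) ∧ m ≤ (φ k + 1) / 2 := fun m => by
    refine hpar.and_eventually ?_
    filter_upwards [eventually_ge_atTop (2 * m)] with k hk
    have hk' : k ≤ φ k := hφ.id_le k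
    omega
  -- the four families of torus Gram inequalities, passed to the limit
  have hsite1 : ∀ a : ℕ, 0 ≤ W (a + a) := fun a => by
    have := gram_rectExpectation_nonneg_of_frequently ρ hρ hlim (fun s t => s + t) R {a}
      (fun _ => 1) ((hfreq a).mono fun k ⟨hk, hk'⟩ => by
        haveI : NeZero (φ k + 1) := ⟨Nat.succ_ne_zero _⟩
        exact gram_wilsonLoop_nonneg_even ρ hk hρ β h1 R {a}
          (fun s hs => by rw [Finset.mem_singleton] at hs; omega) _)
    simpa [hW] using this
  have hlink1 : ∀ a : ℕ, 0 ≤ W (a + a + 1) := fun a => by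
    have := gram_rectExpectation_nonneg_of_frequently ρ hρ hlim (fun s t => s + t + 1) R {a}
      (fun _ => 1) ((hfreq (a + 1)).mono fun k ⟨hk, hk'⟩ => by
        haveI : NeZero (φ k + 1) := ⟨Nat.succ_ne_zero _⟩
        exact gram_wilsonLoop_nonneg_odd ρ hk hρ hβ h1 R {a}
          (fun s hs => by rw [Finset.mem_singleton] at hs; omega) _)
    simpa [hW] using this
  have hsite2 : ∀ (a : ℕ) (x y : ℝ),
      0 ≤ W (a + a) * x ^ 2 + 2 * W (a + a + 1) * x * y + W (a + a + 2) * y ^ 2 := by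
    intro a x y
    have := gram_rectExpectation_nonneg_of_frequently ρ hρ hlim (fun s t => s + t) R {a, a + 1}
      (fun u => if u = a then x else y) ((hfreq (a + 1)).mono fun k ⟨hk, hk'⟩ => by
        haveI : NeZero (φ k + 1) := ⟨Nat.succ_ne_zero _⟩
        exact gram_wilsonLoop_nonneg_even ρ hk hρ β h1 R {a, a + 1}
          (fun s hs => by
            rw [Finset.mem_insert, Finset.mem_singleton] at hs
            omega) _)
    exact quad_of_gram_pair (W := W) (h := fun s t => s + t) (a := a) rfl rfl (by omega)
      (by omega) this
  have hlink2 : ∀ (a : ℕ) (x y : ℝ),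
      0 ≤ W (a + a + 1) * x ^ 2 + 2 * W (a + a + 2) * x * y + W (a + a + 3) * y ^ 2 := by
    intro a x y
    have := gram_rectExpectation_nonneg_of_frequently ρ hρ hlim (fun s t => s + t + 1) R
      {a, a + 1} (fun u => if u = a then x else y) ((hfreq (a + 2)).mono fun k ⟨hk, hk'⟩ => by
        haveI : NeZero (φ k + 1) := ⟨Nat.succ_ne_zero _⟩
        exact gram_wilsonLoop_nonneg_odd ρ hk hρ hβ h1 R {a, a + 1}
          (fun s hs => by
            rw [Finset.mem_insert, Finset.mem_singleton] at hs
            omega) _)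
    exact quad_of_gram_pair (W := W) (h := fun s t => s + t + 1) (a := a) rfl rfl
      (by omega) (by omega) this
  -- parity of `T`
  rcases Nat.even_or_odd' T with ⟨a, rfl | rfl⟩
  · rw [two_mul]
    exact ⟨hsite1 a, StaticPotential.sq_le_mul_of_forall_quadratic_nonneg (hsite2 a)⟩
  · rw [two_mul]
    refine ⟨hlink1 a, ?_⟩
    rw [show a + a + 1 + 1 = a + a + 2 by ring, show a + a + 1 + 2 = a + a + 3 by ring]
    exact StaticPotential.sq_le_mul_of_forall_quadratic_nonneg (hlink2 a)

/-! ### `W(0) = 1` (`W ≤ 1` is `StringTension.abs_rectExpectation_le_one`) -/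

omit [TopologicalSpace G] [IsTopologicalGroup G] [CompactSpace G] [BorelSpace G] in
omit [MeasurableSpace G] in
/-- Straight walks from equal base points have equal holonomies. [folklore] -/
theorem walkHolonomy_lineWalk_congr_base (U : LGConfig d G) (j : Fin d) (R : ℕ)
    {y y' : Literature.Probability.LatticeModels.Site d} (h : y = y') :
    walkHolonomy U (lineWalk j R y) = walkHolonomy U (lineWalk j R y') := by
  subst h
  rfl

omit [TopologicalSpace G] [IsTopologicalGroup G] [CompactSpace G] [MeasurableSpace G] [BorelSpace G] in
/-- The degenerate `0 × R` rectangle has trivial holonomy. [folklore] -/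
theorem walkHolonomy_rectWalk_zero (U : LGConfig d G) (x : Literature.Probability.LatticeModels.Site d)
    (i j : Fin d) (R : ℕ) : walkHolonomy U (rectWalk x i j 0 R) = 1 := by
  have hx : x + Pi.single i (((0 : ℕ) : ℤ)) = x := by simp
  rw [walkHolonomy_rectWalk, walkHolonomy_lineWalk_congr_base U j R hx]
  simp [lineWalk]

omit [TopologicalSpace G] [IsTopologicalGroup G] [CompactSpace G] [BorelSpace G] in
/-- `W_μ(0 × R) = 1` for a probability measure `μ` and `N ≥ 1`. [folklore] -/
theorem rectExpectation_zero_eq_one [NeZero d] (hN : N ≠ 0) (μ : Measure (LGConfig d G))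
    [IsProbabilityMeasure μ] (i j : Fin d) (R : ℕ) :
    rectExpectation μ (fun g => normalisedCharacter N (ρ g)) i j 0 R = 1 := by
  unfold rectExpectation loopExpectation wilsonLoopObs
  simp only [walkHolonomy_rectWalk_zero, map_one, normalisedCharacter, Matrix.trace_one,
    Fintype.card_fin]
  rw [integral_const, probReal_univ, one_smul]
  simp [hN]

/-! ### The theorem along subsequences with infinitely many even tori -/

/-- **The transfer-matrix dichotomy for limit points along subsequences with infinitely many
even tori** (E. Seiler, LNP 159 (1982) §2; Osterwalder–Seiler, Ann. Phys. 110 (1978) §2). Let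
`G` be compact, `ρ` continuous, `β ≥ 0`, `d ≥ 2`, and let `μ` be the limit of the torus Wilson
states along the tori `Λ_{φ k + 1}` with `φ k + 1` even for infinitely many `k`. Then for every
`R` either `W_μ(R, T) = 0` for all `T ≥ 1`, or the static potential `V(R) ≥ 0` exists
(`HasStaticPotential`). Proof: swap the coordinates `0 ↔ 1` (`rectExpectation_eq_swap`; the
swapped state is a limit along the same tori), apply the Gram inequalities of the limit and the
log-convexity dichotomy. [folklore] -/
theorem exists_hasStaticPotential_of_frequently_even [NeZero d] (hd : 2 ≤ d) (hρ : Continuous ρ)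
    {β : ℝ} (hβ : 0 ≤ β) {μ : Measure (LGConfig d G)} {φ : ℕ → ℕ} (hφ : StrictMono φ)
    (hlim : IsInfiniteVolumeLimitAlong ρ β φ μ) (hpar : ∃ᶠ k in atTop, Even (φ k + 1)) (R : ℕ) :
    (∀ T, 1 ≤ T → rectExpectation μ (fun g => normalisedCharacter N (ρ g)) 0 1 R T = 0) ∨
      ∃ V : ℝ, 0 ≤ V ∧ HasStaticPotential μ (fun g => normalisedCharacter N (ρ g)) R V := by
  rcases Nat.eq_zero_or_pos N with hN | hN
  · subst hN
    left
    intro T _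
    simp [rectExpectation, loopExpectation, wilsonLoopObs, normalisedCharacter]
  set χ : G → ℝ := fun g => normalisedCharacter N (ρ g) with hχ
  have hχinv : ∀ g, χ g⁻¹ = χ g := fun g => by
    simp only [hχ, normalisedCharacter,
      Literature.RepresentationTheory.CompactGroups.CompactGroup.re_trace_map_inv ρ hρ]
  set μ' := μ.map (configPermZd (Equiv.swap (0 : Fin d) 1)) with hμ'
  have hlim' : IsInfiniteVolumeLimitAlong ρ β φ μ' :=
    IsInfiniteVolumeLimitAlong.map_configPermZd ρ hρ hlim _
  haveI : IsProbabilityMeasure μ' := hlim'.1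
  have hswap : ∀ T, rectExpectation μ χ 0 1 R T = rectExpectation μ' χ 0 1 T R := fun T =>
    rectExpectation_eq_swap μ χ hχinv R T
  refine StaticPotential.dichotomy_rectExpectation μ χ R ?_ (fun T => ?_) (fun T => ?_) fun T => ?_
  · rw [hswap]
    exact rectExpectation_zero_eq_one ρ hN.ne' μ' 0 1 R
  · rw [hswap]
    exact (le_abs_self _).trans (StringTension.abs_rectExpectation_le_one ρ hρ μ' T R)
  · rw [hswap]
    exact (rectExpectation_nonneg_and_logConvex_of_frequently_even ρ hd hρ hβ hφ hlim' hpar R T).1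
  · rw [hswap, hswap, hswap]
    exact (rectExpectation_nonneg_and_logConvex_of_frequently_even ρ hd hρ hβ hφ hlim' hpar R T).2


/-! ### Subsequences with infinitely many odd tori, and the discharge -/

/-- **The Gram inequalities in the limit (subsequences with infinitely many odd tori).** Same
statement as `rectExpectation_nonneg_and_logConvex_of_frequently_even`, from the reflection
positivity of the odd torus (`gram_wilsonLoop_nonneg_odd_of_odd`,
`gram_wilsonLoop_nonneg_even_of_odd`). [folklore] -/
theorem rectExpectation_nonneg_and_logConvex_of_frequently_odd [NeZero d] (hd : 2 ≤ d)
    (hρ : Continuous ρ) {β : ℝ} (hβ : 0 ≤ β) {μ : Measure (LGConfig d G)} {φ : ℕ → ℕ}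
    (hφ : StrictMono φ) (hlim : IsInfiniteVolumeLimitAlong ρ β φ μ)
    (hpar : ∃ᶠ k in atTop, Odd (φ k + 1)) (R T : ℕ) :
    0 ≤ rectExpectation μ (fun g => normalisedCharacter N (ρ g)) 0 1 T R ∧
      rectExpectation μ (fun g => normalisedCharacter N (ρ g)) 0 1 (T + 1) R ^ 2 ≤
        rectExpectation μ (fun g => normalisedCharacter N (ρ g)) 0 1 T R *
          rectExpectation μ (fun g => normalisedCharacter N (ρ g)) 0 1 (T + 2) R := by
  set W : ℕ → ℝ := fun T => rectExpectation μ (fun g => normalisedCharacter N (ρ g)) 0 1 T R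
    with hW
  have h1 : (1 : Fin d) ≠ 0 := by
    intro h01
    have := congrArg Fin.val h01
    rw [Fin.val_zero, Fin.val_one', Nat.one_mod_eq_one.mpr (by omega)] at this
    exact one_ne_zero this
  have hfreq : ∀ m : ℕ, ∃ᶠ k in atTop, Odd (φ k + 1) ∧ 3 ≤ φ k + 1 ∧ m ≤ (φ k + 1) / 2 := fun m => by
    refine hpar.and_eventually ?_
    filter_upwards [eventually_ge_atTop (2 * m + 2)] with k hk
    have hk' : k ≤ φ k := hφ.id_le k
    omega
  have hsite1 : ∀ a : ℕ, 0 ≤ W (a + a) := fun a => by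
    have := gram_rectExpectation_nonneg_of_frequently ρ hρ hlim (fun s t => s + t) R {a}
      (fun _ => 1) ((hfreq a).mono fun k ⟨hk, hk3, hk'⟩ => by
        haveI : NeZero (φ k + 1) := ⟨Nat.succ_ne_zero _⟩
        exact gram_wilsonLoop_nonneg_even_of_odd ρ hk hk3 hρ hβ h1 R {a}
          (fun s hs => by rw [Finset.mem_singleton] at hs; omega) _)
    simpa [hW] using this
  have hlink1 : ∀ a : ℕ, 0 ≤ W (a + a + 1) := fun a => by
    have := gram_rectExpectation_nonneg_of_frequently ρ hρ hlim (fun s t => s + t + 1) R {a}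
      (fun _ => 1) ((hfreq (a + 1)).mono fun k ⟨hk, hk3, hk'⟩ => by
        haveI : NeZero (φ k + 1) := ⟨Nat.succ_ne_zero _⟩
        exact gram_wilsonLoop_nonneg_odd_of_odd ρ hk hk3 hρ hβ h1 R {a}
          (fun s hs => by rw [Finset.mem_singleton] at hs; omega) _)
    simpa [hW] using this
  have hsite2 : ∀ (a : ℕ) (x y : ℝ),
      0 ≤ W (a + a) * x ^ 2 + 2 * W (a + a + 1) * x * y + W (a + a + 2) * y ^ 2 := by
    intro a x y
    have := gram_rectExpectation_nonneg_of_frequently ρ hρ hlim (fun s t => s + t) R {a, a + 1}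
      (fun u => if u = a then x else y) ((hfreq (a + 1)).mono fun k ⟨hk, hk3, hk'⟩ => by
        haveI : NeZero (φ k + 1) := ⟨Nat.succ_ne_zero _⟩
        exact gram_wilsonLoop_nonneg_even_of_odd ρ hk hk3 hρ hβ h1 R {a, a + 1}
          (fun s hs => by
            rw [Finset.mem_insert, Finset.mem_singleton] at hs
            omega) _)
    exact quad_of_gram_pair (W := W) (h := fun s t => s + t) (a := a) rfl rfl (by omega)
      (by omega) this
  have hlink2 : ∀ (a : ℕ) (x y : ℝ),
      0 ≤ W (a + a + 1) * x ^ 2 + 2 * W (a + a + 2) * x * y + W (a + a + 3) * y ^ 2 := by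
    intro a x y
    have := gram_rectExpectation_nonneg_of_frequently ρ hρ hlim (fun s t => s + t + 1) R
      {a, a + 1} (fun u => if u = a then x else y) ((hfreq (a + 2)).mono fun k ⟨hk, hk3, hk'⟩ => by
        haveI : NeZero (φ k + 1) := ⟨Nat.succ_ne_zero _⟩
        exact gram_wilsonLoop_nonneg_odd_of_odd ρ hk hk3 hρ hβ h1 R {a, a + 1}
          (fun s hs => by
            rw [Finset.mem_insert, Finset.mem_singleton] at hs
            omega) _)
    exact quad_of_gram_pair (W := W) (h := fun s t => s + t + 1) (a := a) rfl rfl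
      (by omega) (by omega) this
  rcases Nat.even_or_odd' T with ⟨a, rfl | rfl⟩
  · rw [two_mul]
    exact ⟨hsite1 a, StaticPotential.sq_le_mul_of_forall_quadratic_nonneg (hsite2 a)⟩
  · rw [two_mul]
    refine ⟨hlink1 a, ?_⟩
    rw [show a + a + 1 + 1 = a + a + 2 by ring, show a + a + 1 + 2 = a + a + 3 by ring]
    exact StaticPotential.sq_le_mul_of_forall_quadratic_nonneg (hlink2 a)

/-- **The Gram inequalities in the limit, along any subsequence of tori** (one of the two
parities occurs infinitely often). [folklore] -/
theorem rectExpectation_nonneg_and_logConvex [NeZero d] (hd : 2 ≤ d)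
    (hρ : Continuous ρ) {β : ℝ} (hβ : 0 ≤ β) {μ : Measure (LGConfig d G)} {φ : ℕ → ℕ}
    (hφ : StrictMono φ) (hlim : IsInfiniteVolumeLimitAlong ρ β φ μ) (R T : ℕ) :
    0 ≤ rectExpectation μ (fun g => normalisedCharacter N (ρ g)) 0 1 T R ∧
      rectExpectation μ (fun g => normalisedCharacter N (ρ g)) 0 1 (T + 1) R ^ 2 ≤
        rectExpectation μ (fun g => normalisedCharacter N (ρ g)) 0 1 T R *
          rectExpectation μ (fun g => normalisedCharacter N (ρ g)) 0 1 (T + 2) R := by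
  by_cases hpar : ∃ᶠ k in atTop, Even (φ k + 1)
  · exact rectExpectation_nonneg_and_logConvex_of_frequently_even ρ hd hρ hβ hφ hlim hpar R T
  · have hodd : ∃ᶠ k in atTop, Odd (φ k + 1) := by
      rw [Filter.not_frequently] at hpar
      exact (hpar.mono fun k hk => Nat.not_even_iff_odd.1 hk).frequently
    exact rectExpectation_nonneg_and_logConvex_of_frequently_odd ρ hd hρ hβ hφ hlim hodd R T

/-- **The transfer-matrix dichotomy for an infinite-volume limit along any subsequence of tori.**
[folklore] -/
theorem exists_hasStaticPotential_of_subseq [NeZero d] (hd : 2 ≤ d) (hρ : Continuous ρ)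
    {β : ℝ} (hβ : 0 ≤ β) {μ : Measure (LGConfig d G)} {φ : ℕ → ℕ} (hφ : StrictMono φ)
    (hlim : IsInfiniteVolumeLimitAlong ρ β φ μ) (R : ℕ) :
    (∀ T, 1 ≤ T → rectExpectation μ (fun g => normalisedCharacter N (ρ g)) 0 1 R T = 0) ∨
      ∃ V : ℝ, 0 ≤ V ∧ HasStaticPotential μ (fun g => normalisedCharacter N (ρ g)) R V := by
  rcases Nat.eq_zero_or_pos N with hN | hN
  · subst hN
    left
    intro T _
    simp [rectExpectation, loopExpectation, wilsonLoopObs, normalisedCharacter]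
  set χ : G → ℝ := fun g => normalisedCharacter N (ρ g) with hχ
  have hχinv : ∀ g, χ g⁻¹ = χ g := fun g => by
    simp only [hχ, normalisedCharacter,
      Literature.RepresentationTheory.CompactGroups.CompactGroup.re_trace_map_inv ρ hρ]
  set μ' := μ.map (configPermZd (Equiv.swap (0 : Fin d) 1)) with hμ'
  have hlim' : IsInfiniteVolumeLimitAlong ρ β φ μ' :=
    IsInfiniteVolumeLimitAlong.map_configPermZd ρ hρ hlim _
  haveI : IsProbabilityMeasure μ' := hlim'.1
  have hswap : ∀ T, rectExpectation μ χ 0 1 R T = rectExpectation μ' χ 0 1 T R := fun T =>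
    rectExpectation_eq_swap μ χ hχinv R T
  refine StaticPotential.dichotomy_rectExpectation μ χ R ?_ (fun T => ?_) (fun T => ?_) fun T => ?_
  · rw [hswap]
    exact rectExpectation_zero_eq_one ρ hN.ne' μ' 0 1 R
  · rw [hswap]
    exact (le_abs_self _).trans (StringTension.abs_rectExpectation_le_one ρ hρ μ' T R)
  · rw [hswap]
    exact (rectExpectation_nonneg_and_logConvex ρ hd hρ hβ hφ hlim' R T).1
  · rw [hswap, hswap, hswap]
    exact (rectExpectation_nonneg_and_logConvex ρ hd hρ hβ hφ hlim' R T).2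

end Limit


/-! ### Discharge of the named fact -/

section Discharge

variable {d N : ℕ} {G : Type*} [Group G] [TopologicalSpace G] [IsTopologicalGroup G]
  [CompactSpace G] [MeasurableSpace G] [BorelSpace G] [NeZero d]
  (ρ : G →* Matrix (Fin N) (Fin N) ℂ)

/-- **constructive-qft.S12, the static potential of an infinite-volume lattice gauge state —
discharge of the named fact `exists_hasStaticPotential`** (E. Seiler, *Gauge Theories as a
Problem of Constructive Quantum Field Theory and Statistical Mechanics*, LNP 159 (1982), §2:
existence of `V(R) = -lim_T T⁻¹ log W(R,T)` from Osterwalder–Seiler reflection positivity and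
the transfer matrix; K. Osterwalder, E. Seiler, Ann. Phys. 110 (1978) 440, §2; K. Wilson, Phys.
Rev. D 10 (1974) 2445 and S. Chatterjee, arXiv:1803.01950 §4 for the definition of `V(R)`). For
a compact group `G`, a continuous unitary matrix representation `ρ`, `β ≥ 0`, `d ≥ 2` and an
infinite-volume limit point `μ` of the torus Wilson states, for every `R ≥ 1`: either
`W_μ(R,T) = 0` for all `T ≥ 1`, or the static potential `V(R) ≥ 0` exists (`HasStaticPotential`).
Proof (all in the tree): the torus Wilson states are reflection positive in hyperplanes between
sites and through sites, on even tori (`wilsonExpectation_nonneg_of_covariant`,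
`wilsonExpectation_siteReflectionPositive`) and on odd tori
(`wilsonExpectation_nonneg_of_oddCovariant`); writing bisected rectangular loops as Gram
pairings of staples gives `W(2s+1) ≥ 0`, `[W(s+t+1)] ≥ 0` resp. `W(2s) ≥ 0`, `[W(s+t)] ≥ 0` on the
tori, hence — one parity occurring infinitely often along the defining subsequence — for the
limit state: `W ≥ 0` and `W(T+1)² ≤ W(T) W(T+2)`; with `W(0) = 1`, `W ≤ 1`, the coordinate swap
`0 ↔ 1` and the log-convexity dichotomy (`StaticPotential.dichotomy_of_logConvex`) the claim
follows. The unitarity hypothesis is not needed (Weyl's unitarian trick). [folklore] -/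
theorem exists_hasStaticPotential_holds : exists_hasStaticPotential (d := d) ρ := by
  intro hd hρ _ β hβ μ hμ R _
  obtain ⟨φ, hφ, hlim⟩ := hμ
  exact exists_hasStaticPotential_of_subseq ρ hd hρ hβ hφ hlim R

end Discharge

end Literature.MathematicalPhysics.QuantumFieldTheory
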